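import Summits.NavierStokesRegularity.FluidComputer.LipschitzSummation
import Summits.NavierStokesRegularity.FluidComputer.LipschitzRowInterpolation
import Summits.NavierStokesRegularity.FluidComputer.LerayClock
import HarnessLib

/-!
# Fluid computer — support: the ν-FREE Riccati inequality of the high rows `Y_κ = ∑_j 2^{κj} ‖Δ̇_j u‖₂²`, `κ > 5`
# (Robinson–Sadowski–Silva 2012 (6.3) in dyadic currency, integrated form)

HONEST FRAMING (cell `pub-fluidc`, verbatim): *low prior, high value-of-information experiment on Tao's
machine paradigm; NOT a claim that NS blows up.* Support file. Along every maximal smooth solution `(u, p)` of the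
unforced Navier–Stokes system on `ℝ³ × [0, T)` (`ν > 0`) which is Leray–Hopf from `u 0`, with `a_j(τ) = ‖Δ̇_j u(τ)‖₂`,
`Y_κ(τ) = ∑_j 2^{κj} a_j(τ)²` (`κ = 2s > 5`):

* `lipschitz_slice_le` — ONE TIME SLICE: for a smooth divergence-free `L²` field `w` with finite `κ`-row and every
  finite set of levels `I`, every `ν ≥ 0`:
  `∑_{j∈I} 2^{κj} (−ν S_j(w) − N_j(w)) ≤ K_κ · ‖w‖₂^{(κ−5)/κ} · Y_κ(w)^{1+5/(2κ)}` — the dissipation is DROPPED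
  (`−ν S_j ≤ 0`), the transfer is slaved to the Lipschitz row (`LipschitzSummation.transfer_row_le_lipschitz`), the
  Lipschitz row to the `Ḃ^{5/2}_{2,1}` row (Bernstein), and that one is interpolated between the energy and `Y_κ`
  (`LipschitzRowInterpolation.lipRow_le_interpolate`);
* `eLpNorm_le_of_le` — the energy never increases after an interior time (`LerayClock.isLerayHopfOn_translate`);
* `row_two_point_high` (**THE ν-FREE RICCATI INEQUALITY OF THE HIGH ROWS, integrated**) — one `K = K_κ > 0` with
  `Y_κ(t) − Y_κ(s) ≤ K ‖u(s)‖₂^{(κ−5)/κ} ∫_s^t Y_κ(τ)^{1+5/(2κ)} dτ` for all `0 < s ≤ t < T` — Robinson–Sadowski–Silva's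
  `d/dt ‖u‖²_{Ḣ^s} ≤ c_s ‖u‖_{L²}^{1−5/(2s)} ‖u‖_{Ḣ^s}^{2+5/(2s)}` ((6.3), viscosity discarded: an Euler-strength law),
  obtained from the signed block balances × `2^{κj}` summed over `|j| ≤ L`, integrated (`Y_κ` continuous,
  `HighRows.continuousOn_row`) and `L → ∞` — no infinite sum is differentiated.

0 sorry; no definitions; no named facts.

## References

* J. C. Robinson, W. Sadowski, R. P. Silva, J. Math. Phys. 53 (2012) 115618, §III (3.6), (3.10), §VI (6.3).
  [RobinsonSadowskiSilva2012]
* H. Bahouri, J.-Y. Chemin, R. Danchin, Grundlehren 343 (2011), Lemma 2.1, Lemma 2.100. [BahouriCheminDanchin2011]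
-/

noncomputable section

open MeasureTheory Set Function Filter Topology
open scoped ENNReal NNReal RealInnerProductSpace
open Literature.Analysis.FluidPDE Literature.Analysis.FunctionSpaces
open Summit.NavierStokesRegularity.FluidComputer.BlockEnergyTransport
open Summit.NavierStokesRegularity.FluidComputer.BlockEnergyIdentity
open Summit.NavierStokesRegularity.FluidComputer.BlockAmplitudeCeiling (exists_blockSup_le_blockL2)
open Summit.NavierStokesRegularity.FluidComputer.LipschitzSummation
open Summit.NavierStokesRegularity.FluidComputer.LipschitzRowInterpolation

namespace Summit.NavierStokesRegularity.FluidComputer.EulerRateInequality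

/-! ## The Lipschitz row against the `Ḃ^{5/2}_{2,1}` row -/

/-- **Bernstein on the Lipschitz row**: with the block Bernstein constant `C_B` of `exists_blockSup_le_blockL2`, for
`v ∈ L²(ℝ³)`: `∑_l 2^l ‖Δ̇_l v‖_∞ ≤ C_B ∑_l 2^{5l/2} ‖Δ̇_l v‖₂`. [cite: BahouriCheminDanchin2011, Lemma 2.1] -/
theorem lipschitzRow_le_lipRow :
    ∃ CB : ℝ≥0, ∀ (v : EuclideanSpace ℝ (Fin 3) → EuclideanSpace ℝ (Fin 3)), MemLp v 2 volume →
      ∑' l : ℤ, (2 : ℝ≥0∞) ^ l * blockSup v l ≤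
        CB * ∑' l : ℤ, (2 : ℝ≥0∞) ^ ((5 / 2 : ℝ) * (l : ℝ)) * blockL2 v l := by
  obtain ⟨CB, -, hB⟩ := exists_blockSup_le_blockL2
  refine ⟨CB, fun v hv => ?_⟩
  rw [← ENNReal.tsum_mul_left]
  refine ENNReal.tsum_le_tsum fun l => ?_
  have epow : (2 : ℝ≥0∞) ^ l * (2 : ℝ≥0∞) ^ (3 * (l : ℝ) / 2) = (2 : ℝ≥0∞) ^ ((5 / 2 : ℝ) * (l : ℝ)) := by
    rw [← ENNReal.rpow_intCast, ← RiccatiSummationGen.two_rpow_add]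
    congr 1; ring
  calc (2 : ℝ≥0∞) ^ l * blockSup v l ≤ (2 : ℝ≥0∞) ^ l * (CB * (2 : ℝ≥0∞) ^ (3 * (l : ℝ) / 2) * blockL2 v l) :=
        mul_le_mul' le_rfl (hB v hv l)
    _ = CB * (((2 : ℝ≥0∞) ^ l * (2 : ℝ≥0∞) ^ (3 * (l : ℝ) / 2)) * blockL2 v l) := by ring
    _ = CB * ((2 : ℝ≥0∞) ^ ((5 / 2 : ℝ) * (l : ℝ)) * blockL2 v l) := by rw [epow]

/-! ## One time slice -/

/-- **THE ν-FREE RICCATI INTEGRAND (one time slice).** For every `κ > 5` there is `K₁ = K₁(κ) > 0` such that for every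
`ν ≥ 0`, every smooth divergence-free `L²` field `w` on `ℝ³` with finite `κ`-row `Y = ∑_j 2^{κj} ‖Δ̇_j w‖₂²`, and every
finite set of levels `I`:
`∑_{j∈I} 2^{κj} (−ν S_j(w) − N_j(w)) ≤ K₁ · ‖w‖₂^{(κ−5)/κ} · Y^{1 + 5/(2κ)}` (real numbers;
`S_j = ∑_i ∫|∂_i Δ̇_j w|² ≥ 0` is dropped, `−N_j ≤ |N_j|`, `∑_j 2^{κj}|N_j| ≤ A_κ Y R` by
`transfer_row_le_lipschitz`, `R ≤ C_B ∑ 2^{5l/2} a_l ≤ C_B C_κ ‖w‖₂^{(κ−5)/κ} Y^{5/(2κ)}`). [cite: RobinsonSadowskiSilva2012, §VI (6.3)]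
[cite: BahouriCheminDanchin2011, Lemma 2.100] -/
theorem lipschitz_slice_le {κ : ℝ} (hκ : 5 < κ) :
    ∃ K₁ : ℝ, 0 < K₁ ∧ ∀ (ν : ℝ), 0 ≤ ν →
      ∀ (w : EuclideanSpace ℝ (Fin 3) → EuclideanSpace ℝ (Fin 3)), IsSmoothL2Field w → VectorCalculus.IsDivFree w →
      ∑' j : ℤ, (2 : ℝ≥0∞) ^ (κ * (j : ℝ)) * blockL2 w j ^ 2 ≠ ∞ → ∀ I : Finset ℤ,
        ∑ j ∈ I, ((2 : ℝ≥0∞) ^ (κ * (j : ℝ))).toReal *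
            (-ν * (∑ i, ∫ x, ‖fderiv ℝ (blockFn j w) x (stdOrthonormalBasis ℝ (EuclideanSpace ℝ (Fin 3)) i)‖ ^ 2) -
              ∫ x, ⟪blockFn j w x, blockFn j (convect w w) x⟫) ≤
          K₁ * (eLpNorm w 2 volume).toReal ^ ((κ - 5) / κ) *
            (∑' j : ℤ, (2 : ℝ≥0∞) ^ (κ * (j : ℝ)) * blockL2 w j ^ 2).toReal ^ (1 + 5 / (2 * κ)) := by
  obtain ⟨A, hAtop, hA⟩ := transfer_row_le_lipschitz (κ := κ) (by linarith)
  obtain ⟨CB, hCB⟩ := lipschitzRow_le_lipRow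
  obtain ⟨C, hC, hint⟩ := lipRow_le_interpolate hκ
  refine ⟨A.toReal * CB * C + 1, by positivity, fun ν hν w hw hdiv hY I => ?_⟩
  set W : ℤ → ℝ≥0∞ := fun j => (2 : ℝ≥0∞) ^ (κ * (j : ℝ)) with hW
  set Y : ℝ≥0∞ := ∑' j : ℤ, W j * blockL2 w j ^ 2 with hYdef
  set S : ℤ → ℝ := fun j => ∑ i, ∫ x, ‖fderiv ℝ (blockFn j w) x (stdOrthonormalBasis ℝ (EuclideanSpace ℝ (Fin 3)) i)‖ ^ 2
    with hS
  set N : ℤ → ℝ := fun j => ∫ x, ⟪blockFn j w x, blockFn j (convect w w) x⟫ with hN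
  set P : ℝ≥0∞ := ∑' l : ℤ, (2 : ℝ≥0∞) ^ ((5 / 2 : ℝ) * (l : ℝ)) * blockL2 w l with hP
  set R : ℝ≥0∞ := ∑' l : ℤ, (2 : ℝ≥0∞) ^ l * blockSup w l with hR
  set E : ℝ := (eLpNorm w 2 volume).toReal with hE
  have hw2 : MemLp w 2 volume := hw.memLp_two
  have hPtop : P ≠ ∞ := lipRow_ne_top hw2 hκ hY
  have hRP : R ≤ CB * P := hCB w hw2
  have hRtop : R ≠ ∞ := ne_top_of_le_ne_top (ENNReal.mul_ne_top ENNReal.coe_ne_top hPtop) hRP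
  have hWtop : ∀ j, W j ≠ ∞ := fun j => RiccatiSlice.two_rpow_ne_top _
  have hS0 : ∀ j, 0 ≤ S j := fun j => Finset.sum_nonneg fun i _ => integral_nonneg fun x => sq_nonneg _
  -- Step 1: drop the dissipation, bound `−N_j` by `|N_j|`
  have h1 : ∑ j ∈ I, (W j).toReal * (-ν * S j - N j) ≤ ∑ j ∈ I, (W j * ‖N j‖ₑ).toReal := by
    refine Finset.sum_le_sum fun j _ => ?_
    rw [ENNReal.toReal_mul, Real.enorm_eq_ofReal_abs, ENNReal.toReal_ofReal (abs_nonneg _)]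
    refine mul_le_mul_of_nonneg_left ?_ ENNReal.toReal_nonneg
    have h := hS0 j
    have hNabs : -N j ≤ |N j| := neg_le_abs _
    nlinarith
  -- Step 2: the window is below the full weighted transfer row, which is slaved to the Lipschitz row
  have h2 : ∑ j ∈ I, (W j * ‖N j‖ₑ).toReal ≤ (A * Y * R).toReal := by
    rw [← ENNReal.toReal_sum fun j _ => ENNReal.mul_ne_top (hWtop j) (by
      rw [Real.enorm_eq_ofReal_abs]; exact ENNReal.ofReal_ne_top)]
    refine ENNReal.toReal_mono (ENNReal.mul_ne_top (ENNReal.mul_ne_top hAtop hY) hRtop) ?_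
    exact (ENNReal.sum_le_tsum I).trans (hA w hw hdiv)
  -- Step 3: the Lipschitz row through the `Ḃ^{5/2}_{2,1}` row and the interpolation
  have h3 : (A * Y * R).toReal ≤ A.toReal * CB * C * E ^ ((κ - 5) / κ) * Y.toReal ^ (1 + 5 / (2 * κ)) := by
    have hR' : R.toReal ≤ CB * P.toReal := by
      have := ENNReal.toReal_mono (ENNReal.mul_ne_top ENNReal.coe_ne_top hPtop) hRP
      rwa [ENNReal.toReal_mul, ENNReal.coe_toReal] at this
    have hP' : P.toReal ≤ C * E ^ ((κ - 5) / κ) * Y.toReal ^ (5 / (2 * κ)) := hint w hw2 hY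
    have hY0 : 0 ≤ Y.toReal := ENNReal.toReal_nonneg
    rw [ENNReal.toReal_mul, ENNReal.toReal_mul]
    calc A.toReal * Y.toReal * R.toReal ≤ A.toReal * Y.toReal * (CB * (C * E ^ ((κ - 5) / κ) * Y.toReal ^ (5 / (2 * κ)))) := by
          gcongr
          exact hR'.trans (mul_le_mul_of_nonneg_left hP' (NNReal.coe_nonneg _))
      _ = A.toReal * CB * C * E ^ ((κ - 5) / κ) * (Y.toReal * Y.toReal ^ (5 / (2 * κ))) := by ring
      _ = A.toReal * CB * C * E ^ ((κ - 5) / κ) * Y.toReal ^ (1 + 5 / (2 * κ)) := by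
          rw [Real.rpow_add' hY0 (by positivity), Real.rpow_one]
  have h4 : A.toReal * CB * C * E ^ ((κ - 5) / κ) * Y.toReal ^ (1 + 5 / (2 * κ)) ≤
      (A.toReal * CB * C + 1) * E ^ ((κ - 5) / κ) * Y.toReal ^ (1 + 5 / (2 * κ)) := by
    have : 0 ≤ E ^ ((κ - 5) / κ) * Y.toReal ^ (1 + 5 / (2 * κ)) := by positivity
    nlinarith
  calc ∑ j ∈ I, (W j).toReal * (-ν * S j - N j) ≤ ∑ j ∈ I, (W j * ‖N j‖ₑ).toReal := h1
    _ ≤ (A * Y * R).toReal := h2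
    _ ≤ A.toReal * CB * C * E ^ ((κ - 5) / κ) * Y.toReal ^ (1 + 5 / (2 * κ)) := h3
    _ ≤ _ := h4

/-! ## The energy never increases after an interior time -/

/-- **Energy monotonicity from an interior time**: along a maximal smooth Leray–Hopf solution of the unforced system
(`ν > 0`), for `0 < s ≤ τ < T`: `‖u(τ)‖₂ ≤ ‖u(s)‖₂` (the translate `u(· + s)` is Leray–Hopf from `u(s)` on
`[0, T₂ − s]` for every `T₂ ∈ (s, T)`, `LerayClock.isLerayHopfOn_translate`). [cite: Leray1934, §19 p. 224] -/
theorem eLpNorm_le_of_le {ν T : ℝ} (hν : 0 < ν) (hT : 0 < T)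
    {u : ℝ → EuclideanSpace ℝ (Fin 3) → EuclideanSpace ℝ (Fin 3)} {p : ℝ → EuclideanSpace ℝ (Fin 3) → ℝ}
    (hmax : IsMaximalSmoothSolution ν 0 u p T) (hLH : IsLerayHopfOn T ν 0 (u 0) u)
    {s τ : ℝ} (hs : 0 < s) (hsτ : s ≤ τ) (hτT : τ < T) :
    eLpNorm (u τ) 2 volume ≤ eLpNorm (u s) 2 volume := by
  set T₂ : ℝ := (τ + T) / 2 with hT₂
  have hT₂I : T₂ ∈ Ioo s T := ⟨by rw [hT₂]; linarith, by rw [hT₂]; linarith⟩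
  have hLHs := LerayClock.isLerayHopfOn_translate hν hT hmax.1 hLH ⟨hs, hsτ.trans_lt hτT⟩ hT₂I
  have hus : MemLp (u s) 2 volume := hLH.memLp s ⟨hs.le, (hsτ.trans_lt hτT).le⟩
  have h := hLHs.eLpNorm_le_eLpNorm_datum hν.le hus (s := τ - s) ⟨by linarith, by rw [hT₂]; linarith⟩
  simpa only [sub_add_cancel] using h

/-! ## The integrated ν-free Riccati inequality -/

/-- **THE ν-FREE RICCATI INEQUALITY OF THE HIGH ROWS, `κ > 5` (Robinson–Sadowski–Silva 2012 (6.3), integrated, dyadic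
currency).** There is `K = K_κ > 0` such that for every `ν > 0`, `T > 0`, every maximal smooth solution `(u, p)` of the
unforced Navier–Stokes system on `ℝ³ × [0, T)` which is Leray–Hopf from `u 0`, and all `0 < s ≤ t < T`:
`Y(t) − Y(s) ≤ K · ‖u(s)‖₂^{(κ−5)/κ} · ∫_s^t Y(τ)^{1+5/(2κ)} dτ`, `Y(τ) = ∑_{j∈ℤ} 2^{κj} ‖Δ̇_j u(τ)‖₂²` — the viscosity
does not enter (`K` depends on `κ` only). Proof: the signed block balances (`blockL2_sq_toReal_sub_eq`) × `2^{κj}` summed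
over `|j| ≤ L`, `lipschitz_slice_le` on each slice with `‖u(τ)‖₂ ≤ ‖u(s)‖₂` (`eLpNorm_le_of_le`), integration in time
(`Y` continuous, `HighRows.continuousOn_row`), `L → ∞`. [cite: RobinsonSadowskiSilva2012, §VI (6.3)] -/
theorem row_two_point_high {κ : ℝ} (hκ : 5 < κ) :
    ∃ K : ℝ, 0 < K ∧ ∀ (ν T : ℝ), 0 < ν → 0 < T →
      ∀ (u : ℝ → EuclideanSpace ℝ (Fin 3) → EuclideanSpace ℝ (Fin 3)) (p : ℝ → EuclideanSpace ℝ (Fin 3) → ℝ),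
      IsMaximalSmoothSolution ν 0 u p T → IsLerayHopfOn T ν 0 (u 0) u →
      ∀ s t : ℝ, 0 < s → s ≤ t → t < T →
        (∑' j : ℤ, (2 : ℝ≥0∞) ^ (κ * (j : ℝ)) * blockL2 (u t) j ^ 2).toReal -
            (∑' j : ℤ, (2 : ℝ≥0∞) ^ (κ * (j : ℝ)) * blockL2 (u s) j ^ 2).toReal ≤
          K * (eLpNorm (u s) 2 volume).toReal ^ ((κ - 5) / κ) *
            ∫ τ in s..t, ((∑' j : ℤ, (2 : ℝ≥0∞) ^ (κ * (j : ℝ)) * blockL2 (u τ) j ^ 2).toReal) ^ (1 + 5 / (2 * κ)) := by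
  obtain ⟨K₁, hK₁, hslice⟩ := lipschitz_slice_le hκ
  refine ⟨2 * K₁, by positivity, fun ν T hν hT u p hmax hLH s t hs hst htT => ?_⟩
  set pw : ℝ := 1 + 5 / (2 * κ) with hpw
  have hκ0 : 0 < κ := by linarith
  have hpw0 : 0 < pw := by rw [hpw]; positivity
  set eκ : ℝ := (κ - 5) / κ with heκ
  have heκ0 : 0 ≤ eκ := by rw [heκ]; exact div_nonneg (by linarith) hκ0.le
  set Es : ℝ := (eLpNorm (u s) 2 volume).toReal with hEs
  have hEs0 : 0 ≤ Es := ENNReal.toReal_nonneg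
  set W : ℤ → ℝ≥0∞ := fun j => (2 : ℝ≥0∞) ^ (κ * (j : ℝ)) with hW
  set Y : ℝ → ℝ := fun τ => (∑' j : ℤ, W j * blockL2 (u τ) j ^ 2).toReal with hY
  set F : ℕ → ℝ → ℝ := fun L τ =>
    ∑ j ∈ Finset.Icc (-(L : ℤ)) L, (W j).toReal * (blockL2 (u τ) j ^ 2).toReal with hF
  set g : ℤ → ℝ → ℝ := fun j τ =>
    -ν * (∑ i, ∫ x, ‖fderiv ℝ (blockFn j (u τ)) x (stdOrthonormalBasis ℝ (EuclideanSpace ℝ (Fin 3)) i)‖ ^ 2) -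
      ∫ x, ⟪blockFn j (u τ) x, blockFn j (convect (u τ) (u τ)) x⟫ with hg
  have hsub : Icc s t ⊆ Ioo 0 T := fun τ hτ => ⟨hs.trans_le hτ.1, hτ.2.trans_lt htT⟩
  have hw : ∀ τ ∈ Icc s t, IsSmoothL2Field (u τ) := fun τ hτ =>
    isSmoothL2Field_slice_of_maximal hν hT hmax hLH (hsub hτ)
  have hdiv : ∀ τ ∈ Icc s t, VectorCalculus.IsDivFree (u τ) := fun τ hτ =>
    hmax.1.divFree τ ⟨(hsub hτ).1.le, (hsub hτ).2⟩
  have hWtop : ∀ j, W j ≠ ∞ := fun j => RiccatiSlice.two_rpow_ne_top _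
  have haj : ∀ τ ∈ Icc s t, ∀ j, blockL2 (u τ) j ^ 2 ≠ ∞ := fun τ hτ j =>
    ENNReal.pow_ne_top (((hw τ hτ).blockFn j).memLp_two).eLpNorm_ne_top
  have hytop : ∀ τ ∈ Icc s t, ∑' j : ℤ, W j * blockL2 (u τ) j ^ 2 ≠ ∞ := fun τ hτ =>
    HighRows.row_ne_top (by linarith) hν hT hmax hLH (hsub hτ)
  have hYc : ContinuousOn Y (Icc s t) := HighRows.continuousOn_row (by linarith) hν hT hmax hLH hs hst htT
  have hY0 : ∀ τ, 0 ≤ Y τ := fun τ => ENNReal.toReal_nonneg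
  have hYpw : IntervalIntegrable (fun τ => Y τ ^ pw) volume s t := by
    refine ContinuousOn.intervalIntegrable ?_
    rw [uIcc_of_le hst]
    exact hYc.rpow_const fun τ _ => Or.inr hpw0.le
  -- energy monotonicity on the window
  have hE : ∀ τ ∈ Icc s t, (eLpNorm (u τ) 2 volume).toReal ^ eκ ≤ Es ^ eκ := fun τ hτ =>
    Real.rpow_le_rpow ENNReal.toReal_nonneg (ENNReal.toReal_mono (hLH.memLp s ⟨hs.le, (hst.trans_lt htT).le⟩).eLpNorm_ne_top
      (eLpNorm_le_of_le hν hT hmax hLH hs hτ.1 (hτ.2.trans_lt htT))) heκ0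
  -- the block balances and their integrability
  have hgint : ∀ j, IntervalIntegrable (g j) volume s t := fun j => by
    obtain ⟨hN, hS, -⟩ := blockL2_sq_toReal_sub_eq hν hT hmax hLH hs hst htT j
    exact (hS.const_mul (-ν)).sub hN
  have hEq : ∀ j, (blockL2 (u t) j ^ 2).toReal - (blockL2 (u s) j ^ 2).toReal = 2 * ∫ τ in s..t, g j τ := fun j =>
    (blockL2_sq_toReal_sub_eq hν hT hmax hLH hs hst htT j).2.2
  -- Step 1: the inequality at level `L`
  have hL : ∀ L : ℕ, F L t - F L s ≤ 2 * (K₁ * Es ^ eκ * ∫ τ in s..t, Y τ ^ pw) := by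
    intro L
    set I : Finset ℤ := Finset.Icc (-(L : ℤ)) L with hI
    have hid : F L t - F L s = 2 * ∫ τ in s..t, ∑ j ∈ I, (W j).toReal * g j τ := by
      show (∑ j ∈ I, (W j).toReal * (blockL2 (u t) j ^ 2).toReal) -
          ∑ j ∈ I, (W j).toReal * (blockL2 (u s) j ^ 2).toReal = _
      rw [← Finset.sum_sub_distrib, intervalIntegral.integral_finsetSum fun j _ => (hgint j).const_mul _,
        Finset.mul_sum]
      refine Finset.sum_congr rfl fun j _ => ?_
      rw [← mul_sub, hEq j, intervalIntegral.integral_const_mul]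
      ring
    have hint : IntervalIntegrable (fun τ => ∑ j ∈ I, (W j).toReal * g j τ) volume s t :=
      (IntervalIntegrable.sum I fun j _ => (hgint j).const_mul ((W j).toReal)).congr fun τ _ => by
        simp only [Finset.sum_apply]
    have hint' : IntervalIntegrable (fun τ => K₁ * Es ^ eκ * Y τ ^ pw) volume s t := hYpw.const_mul _
    have hbound : ∀ τ ∈ Icc s t, ∑ j ∈ I, (W j).toReal * g j τ ≤ K₁ * Es ^ eκ * Y τ ^ pw := by
      intro τ hτ
      have h := hslice ν hν.le (u τ) (hw τ hτ) (hdiv τ hτ) (hytop τ hτ) I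
      refine h.trans ?_
      have hYτ : 0 ≤ Y τ ^ pw := Real.rpow_nonneg (hY0 τ) _
      exact mul_le_mul_of_nonneg_right (mul_le_mul_of_nonneg_left (hE τ hτ) hK₁.le) hYτ
    have hmono := intervalIntegral.integral_mono_on hst hint hint' hbound
    rw [hid]
    rw [intervalIntegral.integral_const_mul] at hmono
    linarith
  -- Step 2: `L → ∞`
  have hlimF : ∀ τ ∈ Icc s t, Tendsto (fun L : ℕ => F L τ) atTop (𝓝 (Y τ)) := by
    intro τ hτ
    have h1 : ∀ L : ℕ, F L τ = (∑ j ∈ Finset.Icc (-(L : ℤ)) L, W j * blockL2 (u τ) j ^ 2).toReal := by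
      intro L
      rw [ENNReal.toReal_sum fun j _ => ENNReal.mul_ne_top (hWtop j) (haj τ hτ j)]
      exact Finset.sum_congr rfl fun j _ => (ENNReal.toReal_mul).symm
    simp_rw [h1]
    exact (ENNReal.tendsto_toReal (hytop τ hτ)).comp (tendsto_sum_Icc_atTop _)
  have hlim := le_of_tendsto_of_tendsto ((hlimF t ⟨hst, le_rfl⟩).sub (hlimF s ⟨le_rfl, hst⟩))
    tendsto_const_nhds (Eventually.of_forall hL)
  have e : 2 * (K₁ * Es ^ eκ * ∫ τ in s..t, Y τ ^ pw) = 2 * K₁ * Es ^ eκ * ∫ τ in s..t, Y τ ^ pw := by ring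
  exact hlim.trans_eq e

end Summit.NavierStokesRegularity.FluidComputer.EulerRateInequality

end
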